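import Summits.CriticalPhenomena.PercolationContinuityZ3.Theorems.PercNearOneGluingNoHeavyLowerTailCubicThreePointInduction
import Summits.CriticalPhenomena.PercolationContinuityZ3.Theorems.PercNearOneGluingNoHeavyLowerTailTerminalEdgeStepXiHqtLeFive
import Summits.CriticalPhenomena.PercolationContinuityZ3.Theorems.PercNearOneGluingNoHeavyLowerTailCubicThreePointGluingMeasure
import Mathlib.Tactic.Ring
import Mathlib.Tactic.Linarith
import Mathlib.Tactic.Positivity
import HarnessLib

/-!
# `NoHeavyLowerTail` (stmt-CriticalPhenomena-4575) — `H_{q+t} ≥ 0` on EVERY finite weighted graph CONDITIONAL on its two four-point apex-edge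
# Bernstein inequalities (BH1),(BH2): the `|D|`-induction driver (the `H_{q+t}` twin of `…CubicThreePointInduction` / `…CubicThreePointTincInduction`)

Support file (prover seat `prim-bnk-1`, gen 7; `--supports stmt-CriticalPhenomena-4575`).  No named facts, no sorries; the only definitions are the weighted
row `hqtW` and the hypothesis `StepHypH` — exact twins of `tincW` / `StepHypT` (prim-e3grp-switch-3, `…CubicThreePointTincInduction`, p204488) and of
prove-2's `shk3W` / `StepHyp` (`…CubicThreePointInduction`), whose finitary weighted-cube framework (cells with forced edges `evQ/evU₁/evU₂/evU₃/evT`,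
one-edge split `PrW_split`, sections `sect_ev*`, transitions `trans_*`, frozen case `frozen_iff`) is reused verbatim.  The explicit step cubics
`hqtB₁`, `hqtB₂` (`= ∇H(x⁰)·x¹`, `∇H(x¹)·x⁰`, three times the Bernstein coefficients), the expansion `Hqt_bernstein_expansion` and the segment lemma
`Hqt_segment_nonneg_of_bernstein` are the ones of `…TerminalEdgeStepXiHqtLeFive` (prim-bnk-1 gen 1, where (BH1),(BH2) are kernel theorems on `≤ 5` vertices,
`hqtStep_le_five`; kit: `≤ 6` vertices, 0 negative three-copy fibres of `4^15`, j077087).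

THE ROW.  `H_{q+t}(q,u₁,u₂,u₃,t) = (q+t)(q t − e₂(u)) − e₃(u)` (`CubicThreePointTerminal.Hqt`; homogeneous cubic in the five cells of the three-point law;
`Hmax ⟹ H_{q+t} ⟹ AG⁺ ⟹ SHK3⁺`; AG⁺ and SHK3⁺ are theorems of the tree, `H_{q+t} ≥ 0` is OPEN — census: 0 negatives on all 309 373 connected 3-terminal
multigraphs `n ≤ 7, m ≤ 10` as the measure shadow of `R2 = M(HQT)`, ttrl mhqt §9).  Along an apex edge `e = {x,m}` (`x` forced-joined to `a`) the law moves by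
the transition masses `α₁ (Q→ab|c), α₂ (Q→ac|b), β₁ (ab|c→abc), β₂ (ac|b→abc), β₃ (bc|a→abc)` and
  `H(x_l) = H(x⁰)(1−l)³ + hqtB₁·(1−l)²l + hqtB₂·(1−l)l² + H(x¹)l³`.
* `StepHypH V` — **(BH1),(BH2)**: `hqtB₁, hqtB₂ ≥ 0` at the cells and transition masses of every `(D, K, p, a, b, c, x ≠ m)` with `x` forced-joined to `a`.
  STATUS (2026-08-20T04:10Z): OPEN; theorem on `≤ 5` vertices; 0 violations on 3.13·10⁶ exact instances `n ≤ 7` (ttrl bern4 "H_{q+t} census"); NO polynomial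
  certificate over the bern4-265 / theorem-rows dictionaries (first-order pseudo-laws, prim-facecert 23:15Z, prim-bnk-1 FINDING-gen4) — BUT every one of those 20
  pseudo-laws is cut by PROVED Π4 rows of the two-SET van den Berg–Häggström–Kahn conditional-association family (tree `TwoSetConditionalAssociation`;
  ttrl cp-wf3b, wf3lp/HQT-BH.md 04:00Z), so a theorem-rows certificate over the enlarged bank is again possible (ttrl part 2 running).
* `hqt_of_stepHypH` — **THEOREM (conditional)**: `StepHypH V → ∀ D K p ∈ [0,1] a b c, 0 ≤ H_{q+t}(law)`; proof = prove-2's induction verbatim (strong induction on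
  `|D|`, `step_apexH` at whichever terminal the peeled edge touches, using the terminal symmetry of `H_{q+t}`; frozen terminals ⇒ unit law ⇒ `H_{q+t} = 0`).
So: certificates for the two four-point cubics (BH1),(BH2) — in ANY vocabulary that specialises to the `PrW` cells with forced edges (cf. `CubicFourPointL1.massesW_eq_univ`:
forced = weight 1, absent = weight 0) — settle `H_{q+t} ≥ 0` on every finite weighted graph by `apply hqt_of_stepHypH`.
-/

noncomputable section

namespace Summit.CriticalPhenomena.PercolationContinuityZ3.Theorems

namespace CubicThreePointStep

open Finset SimpleGraph Literature.Probability.Percolation.DecisionTree CubicThreePointTerminal TerminalEdgeStep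

/-- The five unit vectors are zeros of `H_{q+t}` (deterministic laws). [folklore] -/
theorem Hqt_unit_eq_zero :
    Hqt (1 : ℝ) 0 0 0 0 = 0 ∧ Hqt (0 : ℝ) 1 0 0 0 = 0 ∧ Hqt (0 : ℝ) 0 1 0 0 = 0 ∧ Hqt (0 : ℝ) 0 0 1 0 = 0 ∧
      Hqt (0 : ℝ) 0 0 0 1 = 0 := by
  refine ⟨?_, ?_, ?_, ?_, ?_⟩ <;> norm_num [Hqt]


variable {V : Type*} [DecidableEq V]

/-- The weighted row: `H_{q+t}` evaluated on the five cells of the three-point law with forced set `K` (twin of `shk3W`, `tincW`). [this work] -/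
def hqtW (D : Finset (Sym2 V)) (p : Sym2 V → ℝ) (K : Finset (Sym2 V)) (a b c : V) : ℝ :=
  Hqt (PrW D p (evQ K a b c)) (PrW D p (evU₁ K a b c)) (PrW D p (evU₂ K a b c)) (PrW D p (evU₃ K a b c))
    (PrW D p (evT K a b c))

section Symmetry

variable (D : Finset (Sym2 V)) (p : Sym2 V → ℝ) (K : Finset (Sym2 V)) (a b c : V)

/-- `H_{q+t}` is symmetric in the terminals: swapping `a,b`. [folklore] -/
theorem hqtW_swap12 : hqtW D p K b a c = hqtW D p K a b c := by
  unfold hqtW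
  rw [evT_swap12 K a b c, evU₁_swap12 K a b c, evU₂_swap12 K a b c, evU₃_swap12 K a b c, evQ_swap12 K a b c]
  simp only [Hqt]
  ring

/-- `H_{q+t}` is symmetric in the terminals: swapping `a,c`. [folklore] -/
theorem hqtW_swap13 : hqtW D p K c b a = hqtW D p K a b c := by
  unfold hqtW
  rw [evT_swap13 K a b c, evU₁_swap13 K a b c, evU₂_swap13 K a b c, evU₃_swap13 K a b c, evQ_swap13 K a b c]
  simp only [Hqt]
  ring

end Symmetry

/-- `H_{q+t}` vanishes when the three terminals are frozen (the law is a unit vector). [folklore] -/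
theorem hqtW_eq_zero_of_frozen (D : Finset (Sym2 V)) (p : Sym2 V → ℝ) (K : Finset (Sym2 V)) (a b c : V)
    (ha : ∀ e ∈ D, ∀ y z : V, e = s(y, z) → y ≠ z → ¬ R K ∅ a y)
    (hb : ∀ e ∈ D, ∀ y z : V, e = s(y, z) → y ≠ z → ¬ R K ∅ b y) :
    hqtW D p K a b c = 0 := by
  have eab : ∀ S, S ⊆ D → (R K S a b ↔ R K ∅ a b) := fun S hS => frozen_iff ha hS b
  have eac : ∀ S, S ⊆ D → (R K S a c ↔ R K ∅ a c) := fun S hS => frozen_iff ha hS c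
  have ebc : ∀ S, S ⊆ D → (R K S b c ↔ R K ∅ b c) := fun S hS => frozen_iff hb hS c
  obtain ⟨f1, f2, f3, f4, f5⟩ := Hqt_unit_eq_zero
  unfold hqtW
  by_cases Pab : R K ∅ a b
  · by_cases Pac : R K ∅ a c
    · rw [PrW_eq_zero_of_forall D p (fun S hS h => h.1 ((eab S hS).2 Pab)),
        PrW_eq_zero_of_forall D p (fun S hS h => h.2 ((eac S hS).2 Pac)),
        PrW_eq_zero_of_forall D p (fun S hS h => h.2 ((eab S hS).2 Pab)),
        PrW_eq_zero_of_forall D p (fun S hS h => h.2 ((eab S hS).2 Pab)),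
        PrW_eq_one_of_forall D p (fun S hS => show S ∈ evT K a b c from ⟨(eab S hS).2 Pab, (eac S hS).2 Pac⟩)]
      exact f5
    · rw [PrW_eq_zero_of_forall D p (fun S hS h => h.1 ((eab S hS).2 Pab)),
        PrW_eq_one_of_forall D p (fun S hS => show S ∈ evU₁ K a b c from ⟨(eab S hS).2 Pab, fun h => Pac ((eac S hS).1 h)⟩),
        PrW_eq_zero_of_forall D p (fun S hS h => Pac ((eac S hS).1 h.1)),
        PrW_eq_zero_of_forall D p (fun S hS h => h.2 ((eab S hS).2 Pab)),
        PrW_eq_zero_of_forall D p (fun S hS h => Pac ((eac S hS).1 h.2))]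
      exact f2
  · by_cases Pac : R K ∅ a c
    · have Pbc : ¬ R K ∅ b c := fun h => Pab (Pac.trans h.symm)
      rw [PrW_eq_zero_of_forall D p (fun S hS h => h.2.1 ((eac S hS).2 Pac)),
        PrW_eq_zero_of_forall D p (fun S hS h => Pab ((eab S hS).1 h.1)),
        PrW_eq_one_of_forall D p (fun S hS => show S ∈ evU₂ K a b c from ⟨(eac S hS).2 Pac, fun h => Pab ((eab S hS).1 h)⟩),
        PrW_eq_zero_of_forall D p (fun S hS h => Pbc ((ebc S hS).1 h.1)),
        PrW_eq_zero_of_forall D p (fun S hS h => Pab ((eab S hS).1 h.1))]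
      exact f3
    · by_cases Pbc : R K ∅ b c
      · rw [PrW_eq_zero_of_forall D p (fun S hS h => h.2.2 ((ebc S hS).2 Pbc)),
          PrW_eq_zero_of_forall D p (fun S hS h => Pab ((eab S hS).1 h.1)),
          PrW_eq_zero_of_forall D p (fun S hS h => Pac ((eac S hS).1 h.1)),
          PrW_eq_one_of_forall D p (fun S hS => show S ∈ evU₃ K a b c from ⟨(ebc S hS).2 Pbc, fun h => Pab ((eab S hS).1 h)⟩),
          PrW_eq_zero_of_forall D p (fun S hS h => Pab ((eab S hS).1 h.1))]
        exact f4
      · rw [PrW_eq_one_of_forall D p (fun S hS => show S ∈ evQ K a b c from ⟨fun h => Pab ((eab S hS).1 h),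
            fun h => Pac ((eac S hS).1 h), fun h => Pbc ((ebc S hS).1 h)⟩),
          PrW_eq_zero_of_forall D p (fun S hS h => Pab ((eab S hS).1 h.1)),
          PrW_eq_zero_of_forall D p (fun S hS h => Pac ((eac S hS).1 h.1)),
          PrW_eq_zero_of_forall D p (fun S hS h => Pbc ((ebc S hS).1 h.1)),
          PrW_eq_zero_of_forall D p (fun S hS h => Pab ((eab S hS).1 h.1))]
        exact f1

/-- **(BH1),(BH2) of the apex-edge induction for `H_{q+t}`, as a hypothesis.**  For every random-edge set `D`, forced set `K`, weights
`p ∈ [0,1]`, terminals `a,b,c` and apex edge `{x,m}` (`x ≠ m`, `x` forced-joined to `a`): `hqtB₁, hqtB₂ ≥ 0` at the cells of the law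
with forced set `K` and the five transition masses towards `K ∪ {{x,m}}`.  OPEN in general (theorem on `≤ 5` vertices: `TerminalEdgeStep.hqtStep_le_five`;
0 violations on 3.13·10⁶ exact instances `n ≤ 7`, ttrl bern4; all first-order pseudo-laws against it are cut by two-set BHK rows, ttrl wf3lp/HQT-BH.md). [this work] -/
def StepHypH (V : Type*) [DecidableEq V] : Prop :=
  ∀ (D K : Finset (Sym2 V)) (p : Sym2 V → ℝ), (∀ i, 0 ≤ p i) → (∀ i, p i ≤ 1) →
    ∀ (a b c x m : V), x ≠ m → (∀ S : Finset (Sym2 V), R K S a x) →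
      0 ≤ hqtB₁ (PrW D p (evQ K a b c)) (PrW D p (evU₁ K a b c)) (PrW D p (evU₂ K a b c))
            (PrW D p (evU₃ K a b c)) (PrW D p (evT K a b c))
            (PrW D p (evQ K a b c ∩ evU₁ (insert s(x, m) K) a b c))
            (PrW D p (evQ K a b c ∩ evU₂ (insert s(x, m) K) a b c))
            (PrW D p (evU₁ K a b c ∩ evT (insert s(x, m) K) a b c))
            (PrW D p (evU₂ K a b c ∩ evT (insert s(x, m) K) a b c))
            (PrW D p (evU₃ K a b c ∩ evT (insert s(x, m) K) a b c)) ∧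
        0 ≤ hqtB₂ (PrW D p (evQ K a b c)) (PrW D p (evU₁ K a b c)) (PrW D p (evU₂ K a b c))
            (PrW D p (evU₃ K a b c)) (PrW D p (evT K a b c))
            (PrW D p (evQ K a b c ∩ evU₁ (insert s(x, m) K) a b c))
            (PrW D p (evQ K a b c ∩ evU₂ (insert s(x, m) K) a b c))
            (PrW D p (evU₁ K a b c ∩ evT (insert s(x, m) K) a b c))
            (PrW D p (evU₂ K a b c ∩ evT (insert s(x, m) K) a b c))
            (PrW D p (evU₃ K a b c ∩ evT (insert s(x, m) K) a b c))

section Induction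

variable {p : Sym2 V → ℝ} (hp0 : ∀ i, 0 ≤ p i) (hp1 : ∀ i, p i ≤ 1)
include hp0 hp1

/-- **The apex step for `H_{q+t}`.**  If `e = {x,m} ∈ D`, `x ≠ m`, `x` is forced-joined to `a`, `H_{q+t} ≥ 0` holds for `(D ∖ e, K)` and `(D ∖ e, K ∪ {e})`,
and (BH1),(BH2) hold, then `H_{q+t} ≥ 0` for `(D, K)`. [this work] -/
theorem step_apexH (hstep : StepHypH V) {D K : Finset (Sym2 V)} {a b c x m : V} (hxm : x ≠ m)
    (hax : ∀ S : Finset (Sym2 V), R K S a x) (he : s(x, m) ∈ D)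
    (ih0 : 0 ≤ hqtW (D.erase s(x, m)) p K a b c) (ih1 : 0 ≤ hqtW (D.erase s(x, m)) p (insert s(x, m) K) a b c) :
    0 ≤ hqtW D p K a b c := by
  set e := s(x, m) with he_def
  set D' := D.erase e with hD'
  have heD' : e ∉ D' := Finset.notMem_erase e D
  have hD : D = insert e D' := (Finset.insert_erase he).symm
  have sq : PrW D p (evQ K a b c) = (1 - p e) * PrW D' p (evQ K a b c) + p e * PrW D' p (evQ (insert e K) a b c) := by
    rw [hD, PrW_split D' p heD', sect_evQ]
  have s1 : PrW D p (evU₁ K a b c) = (1 - p e) * PrW D' p (evU₁ K a b c) + p e * PrW D' p (evU₁ (insert e K) a b c) := by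
    rw [hD, PrW_split D' p heD', sect_evU₁]
  have s2 : PrW D p (evU₂ K a b c) = (1 - p e) * PrW D' p (evU₂ K a b c) + p e * PrW D' p (evU₂ (insert e K) a b c) := by
    rw [hD, PrW_split D' p heD', sect_evU₂]
  have s3 : PrW D p (evU₃ K a b c) = (1 - p e) * PrW D' p (evU₃ K a b c) + p e * PrW D' p (evU₃ (insert e K) a b c) := by
    rw [hD, PrW_split D' p heD', sect_evU₃]
  have sT : PrW D p (evT K a b c) = (1 - p e) * PrW D' p (evT K a b c) + p e * PrW D' p (evT (insert e K) a b c) := by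
    rw [hD, PrW_split D' p heD', sect_evT]
  have tQ := trans_Q D' p (K := K) (b := b) (c := c) (m := m) hax
  have t1 := trans_U₁ D' p (K := K) (a := a) (b := b) (c := c) (x := x) (m := m)
  have t2 := trans_U₂ D' p (K := K) (a := a) (b := b) (c := c) (x := x) (m := m)
  have t3 := trans_U₃ D' p (K := K) (b := b) (c := c) (m := m) hax
  have tT := trans_T D' p (K := K) (b := b) (c := c) (m := m) hax
  set q := PrW D' p (evQ K a b c)
  set u₁ := PrW D' p (evU₁ K a b c)
  set u₂ := PrW D' p (evU₂ K a b c)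
  set u₃ := PrW D' p (evU₃ K a b c)
  set t := PrW D' p (evT K a b c)
  set α₁ := PrW D' p (evQ K a b c ∩ evU₁ (insert e K) a b c)
  set α₂ := PrW D' p (evQ K a b c ∩ evU₂ (insert e K) a b c)
  set β₁ := PrW D' p (evU₁ K a b c ∩ evT (insert e K) a b c)
  set β₂ := PrW D' p (evU₂ K a b c ∩ evT (insert e K) a b c)
  set β₃ := PrW D' p (evU₃ K a b c ∩ evT (insert e K) a b c)
  have hq1 : PrW D' p (evQ (insert e K) a b c) = q - α₁ - α₂ := by linarith
  have hu1 : PrW D' p (evU₁ (insert e K) a b c) = u₁ + α₁ - β₁ := by linarith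
  have hu2 : PrW D' p (evU₂ (insert e K) a b c) = u₂ + α₂ - β₂ := by linarith
  have hu3 : PrW D' p (evU₃ (insert e K) a b c) = u₃ - β₃ := by linarith
  have ht1 : PrW D' p (evT (insert e K) a b c) = t + β₁ + β₂ + β₃ := by linarith
  obtain ⟨hB1, hB2⟩ := hstep D' K p hp0 hp1 a b c x m hxm hax
  have h3 : 0 ≤ Hqt (q - α₁ - α₂) (u₁ + α₁ - β₁) (u₂ + α₂ - β₂) (u₃ - β₃) (t + β₁ + β₂ + β₃) := by
    have := ih1
    unfold hqtW at this
    rwa [hq1, hu1, hu2, hu3, ht1] at this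
  have h0 : 0 ≤ Hqt q u₁ u₂ u₃ t := ih0
  have key := Hqt_segment_nonneg_of_bernstein h0 h3 hB1 hB2 (hp0 e) (hp1 e)
  unfold hqtW
  rw [sq, s1, s2, s3, sT, hq1, hu1, hu2, hu3, ht1]
  have e1 : (1 - p e) * q + p e * (q - α₁ - α₂) = q + p e * (-α₁ - α₂) := by ring
  have e2 : (1 - p e) * u₁ + p e * (u₁ + α₁ - β₁) = u₁ + p e * (α₁ - β₁) := by ring
  have e3 : (1 - p e) * u₂ + p e * (u₂ + α₂ - β₂) = u₂ + p e * (α₂ - β₂) := by ring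
  have e4 : (1 - p e) * u₃ + p e * (u₃ - β₃) = u₃ + p e * (-β₃) := by ring
  have e5 : (1 - p e) * t + p e * (t + β₁ + β₂ + β₃) = t + p e * (β₁ + β₂ + β₃) := by ring
  rw [e1, e2, e3, e4, e5]
  exact key

/-- **`H_{q+t} ≥ 0` for every finite weighted graph, from the step hypothesis (BH1),(BH2)** (strong induction on the number of random edges;
frozen case `hqtW_eq_zero_of_frozen`, step `step_apexH` at whichever terminal the chosen edge touches, moved to `a` by the terminal symmetry). [this work] -/
theorem hqtW_nonneg_of_stepHypH (hstep : StepHypH V) :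
    ∀ (n : ℕ) (D K : Finset (Sym2 V)) (a b c : V), D.card = n → 0 ≤ hqtW D p K a b c := by
  intro n
  induction n using Nat.strong_induction_on with
  | _ n ih =>
  intro D K a b c hDn
  by_cases hex : ∃ e ∈ D, ∃ y z : V, e = s(y, z) ∧ y ≠ z ∧ (R K ∅ a y ∨ R K ∅ b y ∨ R K ∅ c y)
  · obtain ⟨e, heD, y, z, rfl, hyz, hreach⟩ := hex
    have hlt : (D.erase s(y, z)).card < n := by rw [← hDn]; exact Finset.card_erase_lt_of_mem heD
    have IH : ∀ (K' : Finset (Sym2 V)) (a' b' c' : V), 0 ≤ hqtW (D.erase s(y, z)) p K' a' b' c' :=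
      fun K' a' b' c' => ih _ hlt _ K' a' b' c' rfl
    rcases hreach with h | h | h
    · exact step_apexH hp0 hp1 hstep hyz (fun S => R_mono_config (Finset.empty_subset S) h) heD (IH _ _ _ _) (IH _ _ _ _)
    · rw [← hqtW_swap12]
      exact step_apexH hp0 hp1 hstep hyz (fun S => R_mono_config (Finset.empty_subset S) h) heD (IH _ _ _ _) (IH _ _ _ _)
    · rw [← hqtW_swap13]
      exact step_apexH hp0 hp1 hstep hyz (fun S => R_mono_config (Finset.empty_subset S) h) heD (IH _ _ _ _) (IH _ _ _ _)
  · push Not at hex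
    have ha : ∀ e ∈ D, ∀ y z : V, e = s(y, z) → y ≠ z → ¬ R K ∅ a y :=
      fun e he y z hyz hne => (hex e he y z hyz hne).1
    have hb : ∀ e ∈ D, ∀ y z : V, e = s(y, z) → y ≠ z → ¬ R K ∅ b y :=
      fun e he y z hyz hne => (hex e he y z hyz hne).2.1
    rw [hqtW_eq_zero_of_frozen D p K a b c ha hb]

/-- **`H_{q+t} ≥ 0` (`(q+t)(q t − e₂(u)) ≥ e₃(u)`, the cubic three-point row between `Hmax` and AG⁺) for bond percolation on every finite graph with
arbitrary edge weights, CONDITIONAL on the apex Bernstein inequalities (BH1),(BH2)** — finitary form: for every random-edge set `D`, forced set `K`,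
weights `p ∈ [0,1]` and terminals `a,b,c`, `0 ≤ H_{q+t}` at the five cells of the law. [this work] -/
theorem hqt_of_stepHypH (hstep : StepHypH V) (D K : Finset (Sym2 V)) (a b c : V) :
    0 ≤ Hqt (PrW D p (evQ K a b c)) (PrW D p (evU₁ K a b c)) (PrW D p (evU₂ K a b c)) (PrW D p (evU₃ K a b c))
      (PrW D p (evT K a b c)) :=
  hqtW_nonneg_of_stepHypH hp0 hp1 hstep D.card D K a b c rfl

end Induction

/-- **Measure-level form** (prim-facecert gen 3).  Under (BH1),(BH2), for every finite vertex type `V`, every weight `w : Sym2 V → [0,1]` and all terminals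
`a,b,c`: `H_{q+t}(μ(a|b|c), μ(ab|c), μ(ac|b), μ(bc|a), μ(abc)) ≥ 0` for `μ = prodBernoulli w` and the `openConn` cells — the tree's percolation vocabulary
(via prim-sahi-p2's bridge `TerminalGluing.real_cellT/U₁/U₂/U₃/Q`, `…CubicThreePointGluingMeasure`). [this work] -/
theorem prodBernoulli_hqt_nonneg_of_stepHypH [Fintype V] (hstep : StepHypH V)
    (w : Sym2 V → unitInterval) (a b c : V) :
    0 ≤ Hqt ((Literature.Probability.LatticeModels.prodBernoulli w).real
              ((Literature.Probability.Percolation.openConn a b)ᶜ ∩ (Literature.Probability.Percolation.openConn a c)ᶜ ∩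
                (Literature.Probability.Percolation.openConn b c)ᶜ))
      ((Literature.Probability.LatticeModels.prodBernoulli w).real
              (Literature.Probability.Percolation.openConn a b ∩ (Literature.Probability.Percolation.openConn a c)ᶜ))
      ((Literature.Probability.LatticeModels.prodBernoulli w).real
              (Literature.Probability.Percolation.openConn a c ∩ (Literature.Probability.Percolation.openConn a b)ᶜ))
      ((Literature.Probability.LatticeModels.prodBernoulli w).real
              (Literature.Probability.Percolation.openConn b c ∩ (Literature.Probability.Percolation.openConn a b)ᶜ))
      ((Literature.Probability.LatticeModels.prodBernoulli w).real
              (Literature.Probability.Percolation.openConn a b ∩ Literature.Probability.Percolation.openConn a c)) := by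
  rw [TerminalGluing.real_cellQ, TerminalGluing.real_cellU₁, TerminalGluing.real_cellU₂, TerminalGluing.real_cellU₃,
    TerminalGluing.real_cellT]
  have h0 : ∀ e : Sym2 V, (0 : ℝ) ≤ ((w e : unitInterval) : ℝ) := fun e => (w e).2.1
  have h1 : ∀ e : Sym2 V, ((w e : unitInterval) : ℝ) ≤ 1 := fun e => (w e).2.2
  exact hqt_of_stepHypH h0 h1 hstep (Finset.univ : Finset (Sym2 V)) ∅ a b c

end CubicThreePointStep

end Summit.CriticalPhenomena.PercolationContinuityZ3.Theorems

end
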